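import Summits.BirchSwinnertonDyer.Rank1Residual.Additive.KodairaDictionaryThree
import Literature.NumberTheory.EllipticCurves.TamagawaRingEquivProofs
import Literature.NumberTheory.EllipticCurves.NeronComponentDataProofs
import Literature.NumberTheory.EllipticCurves.NeronTamagawa
import Literature.NumberTheory.DiophantineGeometry.TateAlgorithmRingEquivProofs
import HarnessLib

/-!
# O5 KL3 part 11a — `3 ∤ c₃(W)` at a TAME additive `3` (`f₃ = 2`): the Tamagawa hypothesis of KL3-B is automatic
# (cell `b2b-bsdres`, lane CLASS-CLOSURE, class O5; seat o5-r2 GEN 21)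

HONEST FRAMING (cell `b2b-bsdres`, run/shared/lean/b2b/bsd-rank1-residual/, verbatim in every file): the goal
of the cell is to DELETE the COMBINATION-SHAPED residual classes of the Birch–Swinnerton-Dyer formula for ALL
analytic-rank `≤ 1` elliptic curves over `ℚ` — "full BSD formula for every rank `≤ 1` curve in class `C`"
assembled STRICTLY from published theorems — so that the rank-`≤ 1` remainder becomes exactly the
CONSTRUCTION-SHAPED classes, which are TYPED (missing-input `Prop`s), NOT attempted. This is not "finishing
BSD". Lane CLASS-CLOSURE: research routes; no claim beyond the stated classes; nothing is booked here; no mark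
of `RESIDUAL-MAP.md` moves; census numbers are EVIDENCE. THEOREMS ONLY (no definition, no named fact, no
conjecture node; net named-fact debt `0`); no node file is touched; O5 stays OPEN.

## What this file does

KL3-B `O5BaseSelmerCountThree` (`O5/HeegnerLogTransportThree.lean` §2b) quantifies over the O5 (t′) scope
`Addv W 3 ∧ 0 ≤ ord₃ j ∧ f₃ = 2` with NO Tamagawa hypothesis, while part 10b §3
(`selmerAcBase_eq_pow_of_addv`, `O5/HeegnerLogTransportThreeGoodSelmer.lean`) proves its count under the
displayed input `3 ∤ c₃(W)`. This file discharges that input from the scope, on tree theorems only: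

* `kodairaSymbolAt_placeOfPrime_eq_placeOf` — the Kodaira symbol of `W/ℚ` at the place of `𝓞 ℚ` over `p`
  (`placeOfPrime p`, currency of `NeronTamagawa` / `localTamagawaNumber_padic_eq`) equals the one at the
  place of `ℤ` over `p` (`Additive.placeOf p`, currency of the census dictionary): both are Tate's algorithm
  over `ℤ_p` (`kodairaSymbolAt_eq_padic`, `TateAlgorithmRingEquivProofs`).
* **`not_three_dvd_localTamagawaNumber_three_of_condExpTwo`** — for `W/ℚ` elliptic, ADDITIVE at `3` with
  `f₃(W) = 2` ("tame" in the census sense): `3 ∤ c₃(W)`. Proof: `f₃ = 2` on the additive locus means Kodaira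
  type `III`, `III*` or `Iₙ*` (`n ≥ 0`) at `3` (`Additive.condExpTwo_three_iff_kodairaSymbolAt_tame`, o5/x4
  dictionary `Additive/KodairaDictionaryThree.lean`, resting on Ogg's formula for the wild types at `p = 3`,
  `OggFormulaWildTypesKodairaProofs`); `c₃ ∣ #Φ₃(𝔽̄₃)` (`localTamagawaNumber_dvd_componentGroupOrder` with the
  discharged `nonempty_neronComponentData_holds`, Kodaira–Néron) and `#Φ = 2, 2, 4` for these types
  (Silverman *ATAEC* Table 4.1); the `ℚ₃`/`ℚ_v` bridge is `localTamagawaNumber_padic_eq_holds`.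
  The potentially-good hypothesis `0 ≤ ord₃ j` of the (t′) scope is NOT needed (type `Iₙ*`, `n ≥ 1`, has
  `c ∈ {2, 4}` as well).
* `padicValNat_localTamagawaNumber_three_eq_zero_of_condExpTwo` — the same as `ord₃ c₃(W) = 0`.

Consequence (part 11b, `O5/HeegnerLogTransportThreeBaseSelmerCount.lean`): KL3-B is a THEOREM modulo the two
textbook facts of part 10a and Kolyvagin's theorem. For the END theorems of part 9 nothing changes (their
`htam : 3 ∤ ∏ c_ℓ(W)` is a condition at the OTHER bad primes of `W`: by this file the (t′) prime `3` itself
never contributes). O5 OPEN; nothing booked; census = EVIDENCE.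

References: [SilvermanATAEC1994] J. H. Silverman, *Advanced Topics in the Arithmetic of Elliptic Curves*,
GTM 151 (1994), IV.9 Cor. 9.2 (c),(d), Tate's algorithm 9.4, Table 4.1 (PDF pp. 340–346, 365), IV.10.4,
IV.11.1; [SilvermanAEC2009] VII.6.1, VII.6 Ex. 7.6; cell files `Additive/KodairaDictionaryThree.lean`,
`Additive/KodairaCondExpThree.lean`, `O5/HeegnerLogTransportThree.lean` (KL3-B),
`O5/HeegnerLogTransportThreeGoodSelmer.lean` (part 10b §3).

## TYPER PLACEMENT NOTE

Imports TREE files only. THEOREMS only, namespace `Summit.BirchSwinnertonDyer.Rank1Residual.O5.HeegnerLogTransport`;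
no `def`. `lean check` rc 0, 0 sorries, 0 warnings; axioms `propext`, `Classical.choice`, `Quot.sound`
(o5-r2 GEN 21). Target path `O5/HeegnerLogTransportThreeTameTamagawa.lean`; part 11b imports it by that name.

## TYPER PLACEMENT NOTE (cc-typer-5 GEN 18 = O5 §3.5 / O6 §3.4 typer of record; by-name ask A-O5-G21-1b of o5-r2 GEN 21, HOME/INBOX.md l.13997: 'place by sha')

Source: `HOME/b2b-bsdres-o5-r2/gen21/lean/HeegnerLogTransportThreeTameTamagawa.lean` sha16 `4abcf02fb343a418` (129 l.; `gen21/SHA16.txt`; o5-r2's `lean check` rc 0 / 0 warnings / axioms std), re-hashed by the typer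
right before writing; THIS file = KL3 part 11a = the source VERBATIM + this paragraph (imports, module text, every declaration block byte-identical; script
`class-closure/typer-5/gen18/g21b_place.py`); the typer's own farm check (this file over the tree, or jointly with its not-yet-built predecessor) rc 0 / 0 warnings, axioms std;
DEDUP `lean search --decl` on the new names: no match.  CONTENT LABELS (source, unchanged): THEOREMS ONLY — 0 `def`, 0 `@[conjecture]`, 0 Literature facts (net named-fact
debt 0), no `sorry`; published inputs stay displayed hypotheses BY NAME.  KL3 parts in the tree: 1–3 p340741 / p341262 / p341640, Global p342632, OrdCompanion p343587 +
p344465, OrdSelmer p345030 + p345686, OrdTwist p346273, Residual Engine / Residual / End p347366 / p348865 / p350277, BaseSelmer p349318, ExactCount p349954, GoodSelmer p350559,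
Literature index lemma p344022, Literature Kriz–Li Thm 1.16 fact p350088 (lit, A314).  HONEST FRAMING (cell `b2b-bsdres`): research route, lane CLASS-CLOSURE §3.5 O5; nothing asserted
beyond the displayed binders, nothing booked, no mark of `RESIDUAL-MAP.md` moves; census = EVIDENCE, never a Literature fact; O5 OPEN.
-/

set_option autoImplicit false

noncomputable section

open scoped Classical NumberField

open WeierstrassCurve IsDedekindDomain IsDedekindDomain.HeightOneSpectrum NumberField
open Literature.NumberTheory.EllipticCurves Literature.NumberTheory.EllipticCurves.Rank1Residual
  Literature.NumberTheory.DiophantineGeometry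

namespace Summit.BirchSwinnertonDyer.Rank1Residual.O5.HeegnerLogTransport

/-! ## §1 The two place currencies over `ℚ` carry the same Kodaira symbol -/

/-- **The Kodaira symbol at the place of `𝓞 ℚ` over `p` equals the one at the place of `ℤ` over `p`**: both
are the symbol of `W ⊗ ℚ_p` computed over `ℤ_p` (`kodairaSymbolAt_eq_padic`), and both places map to `p`
under `primesEquiv`. [folklore] -/
theorem kodairaSymbolAt_placeOfPrime_eq_placeOf (W : WeierstrassCurve ℚ) [W.IsElliptic] (p : ℕ)
    [Fact p.Prime] :
    W.kodairaSymbolAt (placeOfPrime p) = W.kodairaSymbolAt (Additive.placeOf p) := by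
  let e : Nat.Primes → KodairaSymbol := fun q =>
    haveI : Fact q.1.Prime := ⟨q.2⟩
    (W.baseChange ℚ_[q]).kodairaSymbol ℤ_[q]
  have h1 : W.kodairaSymbolAt (placeOfPrime p) =
      e (Rat.HeightOneSpectrum.primesEquiv (placeOfPrime p)) :=
    W.kodairaSymbolAt_eq_padic _
  have h2 : W.kodairaSymbolAt (Additive.placeOf p) =
      e (Rat.HeightOneSpectrum.primesEquiv (R := ℤ) (Additive.placeOf p)) :=
    W.kodairaSymbolAt_eq_padic _
  have h3 : Rat.HeightOneSpectrum.primesEquiv (placeOfPrime p) =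
      Rat.HeightOneSpectrum.primesEquiv (R := ℤ) (Additive.placeOf p) := by
    simp [placeOfPrime, Additive.placeOf]
  rw [h1, h2, h3]

/-! ## §2 `3 ∤ c₃(W)` at a tame additive `3` -/

/-- **`3 ∤ c₃(W)` for `W/ℚ` additive at `3` with `f₃(W) = 2`.** On the additive locus `f₃ = 2` means
Kodaira type `III`, `III*` or `Iₙ*` (`n ≥ 0`) at `3` (`Additive.condExpTwo_three_iff_kodairaSymbolAt_tame`:
the wild types `II, IV, IV*, II*` have `f₃ ≥ 3` by Ogg's formula at `p = 3`), the local Tamagawa number divides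
the order `#Φ₃(𝔽̄₃) = 2, 2, 4` of the geometric component group (`localTamagawaNumber_dvd_componentGroupOrder`,
Kodaira–Néron, Silverman *ATAEC* Cor. IV.9.2 and Table 4.1), and `3 ∤ 2, 4`. The `ℚ₃`-currency of KL3-B /
part 10b is reached through `localTamagawaNumber_padic_eq_holds`. In particular the Tamagawa input
`3 ∤ c₃(W)` of part 10b §3 holds on the whole O5 (t′) scope (there the type is `III` or `III*`, `c₃ = 2`).
[cite: SilvermanATAEC1994, IV.9 Cor. 9.2 (c),(d), 9.4 and Table 4.1 (PDF pp. 340–346, 365)]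
[cite: SilvermanAEC2009, VII.6.1 and VII.6 Ex. 7.6] -/
theorem not_three_dvd_localTamagawaNumber_three_of_condExpTwo (W : WeierstrassCurve ℚ) [W.IsElliptic]
    (hadd : Addv W 3) (hf₂ : Additive.CondExpTwo W 3) :
    ¬ 3 ∣ (W.baseChange ℚ_[3]).localTamagawaNumber ℤ_[3] := by
  have htame := (Additive.condExpTwo_three_iff_kodairaSymbolAt_tame W hadd).mp hf₂
  haveI : Finite (IsLocalRing.ResidueField ((placeOfPrime 3).adicCompletionIntegers ℚ)) :=
    HeightOneSpectrum.finite_residueField_adicCompletionIntegers ℚ (placeOfPrime 3)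
  intro hdvd
  rw [localTamagawaNumber_padic_eq_holds W (placeOfPrime 3) 3 (primesEquiv_placeOfPrime 3)] at hdvd
  have hcgo := hdvd.trans (localTamagawaNumber_dvd_componentGroupOrder (placeOfPrime 3) W
    (nonempty_neronComponentData_holds W _))
  rw [kodairaSymbolAt_placeOfPrime_eq_placeOf W 3] at hcgo
  rcases htame with h | h | ⟨n, h⟩ <;> rw [h] at hcgo <;>
    simp [KodairaSymbol.componentGroupOrder] at hcgo

/-- **`ord₃ c₃(W) = 0`** at a tame additive `3` (`padicValNat` form of the previous theorem, the currency of
part 10a's exponent). [cite: SilvermanATAEC1994, IV.9 Cor. 9.2 (c),(d) and Table 4.1 (PDF pp. 340, 365)] -/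
theorem padicValNat_localTamagawaNumber_three_eq_zero_of_condExpTwo (W : WeierstrassCurve ℚ)
    [W.IsElliptic] (hadd : Addv W 3) (hf₂ : Additive.CondExpTwo W 3) :
    padicValNat 3 ((W.baseChange ℚ_[3]).localTamagawaNumber ℤ_[3]) = 0 :=
  padicValNat.eq_zero_of_not_dvd (not_three_dvd_localTamagawaNumber_three_of_condExpTwo W hadd hf₂)

end Summit.BirchSwinnertonDyer.Rank1Residual.O5.HeegnerLogTransport

end
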